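/-
PORT (pub-hodgecm2, COR-CM cell; count-neutral own lane PERL34-DISCHARGE, seat prover-pub-hodgecm2-b26-g22-0, 2026-08-21) of the stage-1
package file `HodgeCMPerL/HodgeCM/Prior/Perl34.lean` (pub-hodgecm HOME/lean, bytes of record md5 a2455d388f0d, 1862 lines), SECTION C4a =
its lines 1329–1574: [PerL] v5 Lemma 4.1(c) (lem:arch(c), tex ll. 488–523), the H_occ DISCHARGE over the abstract isolation interface of
the tree's `Perl34IsolationSetting.lean` (p277216): `C4a.PointedCore C` (point evaluations of C([G_U]) separating functions), the point
functionals `pointFunctional` with continuity and sup-norm detection `exists_evalPt_ne_zero`, the tier-A Witt lemma for sesquilinear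
forms (`SesqForm`, `IsSplitFrame`, `witt_sign_to_sign`), the per-side package `C4a.OccDischarge D P` with
`OccDischarge.H_occ` = the frozen hypothesis `IsolationSetting.H_occ12/34` of PerL Thm 3.7, and the constructor
`C4a.mkIsolationSetting` assembling an `IsolationSetting` from two torus sides + one `PointedCore` + the C4/C4a packages (as the package's
`Automorphic/CharsOccJoin.lean` and its `SmokeS4.setting` do).  Declarations and proofs VERBATIM; edits: this header, `import` of the
C4 port, outer namespace token `HodgeCM.Prior.Perl34File` ↦ `Summit.HodgeConjecture.CorCM.Prior.Perl34File`, the package's file-local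
notation `⟪x, y⟫ := @inner ℂ _ _ x y` replaced by Mathlib's scoped `⟪x, y⟫_ℂ` (identical term), linter fixes listed below if any.
Package consumers of this layer: `HodgeCM/Automorphic/CharsOccJoin.lean` (`occ_of_occPkg`), `HodgeCM/PerL34/ArchC*.lean`,
`S4ModelSeparation.lean`, `PrintedLinEndState.lean` (all over `C4a.PointedCore`).  HONESTY NOTE (from the package): the bridge fields
`wOccurs_of_Pw` + `arch_functional` carry the residual content of the lemma.  FRAMING: HC_CM is NOT proved; nothing here concerns a model.
-/
import Summits.HodgeConjecture.CorCM.Prior.Perl34RallisChars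

namespace Summit.HodgeConjecture.CorCM.Prior.Perl34File

open scoped InnerProductSpace

/-! # C4a = Lemma 4.1(c) (lem:arch(c), [PerL] v5 ll. 488–523) — the H_occ discharge

S4 tranche, third target (plan v2 @e3be098b C4a row, amendment A#9; the deferred
A#8(iii) point-evaluation half, x1 cross-read item M1).  Byte-identical prefix =
C4_Chars.lean (`cmp`-verified in S4/README.md).

ADDED-HYPOTHESIS DISCIPLINE (task M1–M4): the frozen `IsolationSetting` @2def0917 is
NOT edited; the structure it lacks (the points of [G_U] behind C([G_U]), and the
per-place meaning of the bare `wOccurs`) is added HERE as separate structures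
`PointedCore` / `OccDischarge`, every added field flagged `ADDED HYPOTHESIS (M1)` and
listed in S4/FIELDS-DELTA.md for the next x1 cross-read.

PROVED here: the deferred A#8(iii) half — v ↦ 𝒯_Φ(v)(g) is a continuous linear
functional, DERIVED as `pointFunctional` (composition of the frozen sup-norm-bounded
`TΦc` with the added point evaluation), never a field; the L²-to-point nonvanishing
conversion; the tier-A Witt sign-to-sign lemma of A#9(ii); the P_w-fixed-vector
extraction; the discharge `H_occ` in the shape the frozen setting consumes; and the
capstone `mkIsolationSetting` assembling a full `IsolationSetting` from the C4/C4a
packages. -/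

namespace Perl34
namespace C4a

variable {H HG CG G SK SigIdx SigIdxG : Type*}
variable [NormedAddCommGroup H] [InnerProductSpace ℂ H] [CompleteSpace H]
variable [NormedAddCommGroup HG] [InnerProductSpace ℂ HG] [CompleteSpace HG]
variable [NormedAddCommGroup CG] [NormedSpace ℂ CG]
variable [Group G] [TopologicalSpace G] [TopologicalSpace SK]

/-- **The M1 point extension** of the frozen core (never an edit of the freeze): the
points of [G_U] behind C([G_U]), with sup-norm-bounded evaluation.  This is exactly
what the x1 cross-read (MISSING item M1) says C4a needs and Prop 3.6/Thm 3.7 do not: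
"an evaluation CG → (pt → ℂ) bounded by the sup norm, to state l(v) := 𝒯_Φ(v)(g)
and 'nonzero for some g'" ([PerL] ll. 343–346, 513–522). -/
structure PointedCore (C : IsolationCore H HG CG G SK SigIdx SigIdxG) where
  /-- ADDED HYPOTHESIS (M1): the points g of the compact quotient [G_U]
  ([PerL] l. 244, 514 "for some g"). -/
  Pt : Type
  /-- ADDED HYPOTHESIS (M1): evaluation of C([G_U]) at a point, bounded for the sup
  norm ([PerL] ll. 343–346; each eval is a norm-≤-1 functional on C([G_U])). -/
  evalPt : Pt → (CG →L[ℂ] ℂ)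
  /-- ADDED HYPOTHESIS (M1): points separate C([G_U]) — a continuous function
  vanishing at every point of [G_U] is zero (the semantic content of `CG` being a
  FUNCTION space on [G_U]; [PerL] l. 514 "non-zero ... for some g"). -/
  evalPt_sep : ∀ φ : CG, (∀ p, evalPt p φ = 0) → φ = 0

variable (C : IsolationCore H HG CG G SK SigIdx SigIdxG)

/-- **The deferred A#8(iii) half, DERIVED** ([PerL] ll. 518–520, L4.1(c): "it is
continuous for the L²-norm (𝒯_Φ is Hilbert–Schmidt and its image consists of
continuous functions depending continuously on v in the uniform norm)"): the linear
functional l(v) = 𝒯_Φ(v)(g), as the composition of the frozen sup-norm-bounded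
`TΦc` with the added point evaluation — a bounded operator by construction, NOT a
field. -/
noncomputable def pointFunctional (P : PointedCore C) (Φ : SK) (p : P.Pt) :
    H →L[ℂ] ℂ :=
  (P.evalPt p).comp (C.TΦc Φ)

/-- The A#8(iii) continuity statement in the print's form: v ↦ 𝒯_Φ(v)(g) is
continuous. -/
theorem pointFunctional_continuous (P : PointedCore C) (Φ : SK) (p : P.Pt) :
    Continuous fun v : H => P.evalPt p (C.TΦc Φ v) :=
  (pointFunctional C P Φ p).continuous

/-- L²-nonvanishing passes to the sup-norm level: 𝒯_Φ v ≠ 0 in L²([G_U]) forces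
𝒯_Φ v ≠ 0 in C([G_U]) (the frozen composite `TΦ = inclCG ∘ TΦc`). -/
theorem TΦc_ne_zero {Φ : SK} {v : H} (h : C.TΦ Φ v ≠ 0) : C.TΦc Φ v ≠ 0 := by
  intro hc
  apply h
  show C.inclCG (C.TΦc Φ v) = 0
  rw [hc, map_zero]

/-- Points detect sup-norm nonvanishing ([PerL] l. 513–514 "non-zero on 𝒮^κ × σ̂ for
some g"): if 𝒯_Φ v ≠ 0 in C([G_U]) then some point evaluation is nonzero. -/
theorem exists_evalPt_ne_zero (P : PointedCore C) {Φ : SK} {v : H}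
    (h : C.TΦc Φ v ≠ 0) : ∃ p : P.Pt, P.evalPt p (C.TΦc Φ v) ≠ 0 := by
  by_contra hall
  exact h (P.evalPt_sep _ fun p => not_not.mp (not_exists.mp hall p))
/-! ## The tier-A Witt lemma (plan C4a(ii), amendment A#9)

[PerL] ll. 476–478: "the local data (W_{i,b}, μ_{i,b}, χ_V, ψ) depend on i only
through the sign of W_{i,b}"; ll. 341–345, 505–513: the (12)- and (34)-adapted Fock
decompositions of the same ω_{W,b} share their κ_b-part.  The bookkeeping brick is:
two orthogonal (+,−) splittings of a (1,1)-plane are isometric SIGN-TO-SIGN.  We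
hand-roll the minimal hermitian-form layer (no mathlib sesquilinear bundle needed)
and prove the frame isometry on coordinates. -/

/-- A hermitian (sesquilinear, conjugate-symmetric) form on a ℂ-module — the minimal
hand-rolled layer: additive and ℂ-linear in the FIRST argument, conjugate-symmetric;
conjugate-linearity in the second argument is derived. -/
structure SesqForm (E : Type) [AddCommGroup E] [Module ℂ E] where
  B : E → E → ℂ
  add_left : ∀ x y z : E, B (x + y) z = B x z + B y z
  smul_left : ∀ (c : ℂ) (x y : E), B (c • x) y = c * B x y
  conj_symm : ∀ x y : E, B y x = (starRingEnd ℂ) (B x y)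

namespace SesqForm

variable {E : Type} [AddCommGroup E] [Module ℂ E] (F : SesqForm E)

/-- (no docstring in the 2001 source) -/
theorem add_right (x y z : E) : F.B x (y + z) = F.B x y + F.B x z := by
  rw [F.conj_symm (y + z) x, F.add_left, map_add, ← F.conj_symm, ← F.conj_symm]

/-- (no docstring in the 2001 source) -/
theorem smul_right (c : ℂ) (x y : E) :
    F.B x (c • y) = (starRingEnd ℂ) c * F.B x y := by
  rw [F.conj_symm (c • y) x, F.smul_left, map_mul, ← F.conj_symm]

/-- (no docstring in the 2001 source) -/
theorem zero_left (y : E) : F.B 0 y = 0 := by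
  have h := F.smul_left 0 0 y
  rw [zero_smul] at h
  simpa using h

end SesqForm

/-- An orthogonal (+,−) frame of a hermitian plane: a unit-positive and a
unit-negative vector, orthogonal ([PerL] l. 476–478: the two lines W_{1,b}, W_{2,b}
of a (1,1)-place, resp. W_{3,b}, W_{4,b}). -/
structure IsSplitFrame {E : Type} [AddCommGroup E] [Module ℂ E]
    (F : SesqForm E) (ep en : E) : Prop where
  pos : F.B ep ep = 1
  neg : F.B en en = -1
  orth : F.B ep en = 0

namespace IsSplitFrame

variable {E : Type} [AddCommGroup E] [Module ℂ E] {F : SesqForm E}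

/-- (no docstring in the 2001 source) -/
theorem orth' {ep en : E} (h : IsSplitFrame F ep en) : F.B en ep = 0 := by
  rw [F.conj_symm, h.orth, map_zero]

/-- The Gram expansion of a frame: B(a·e₊ + b·e₋, a′·e₊ + b′·e₋) = a·ā′ − b·b̄′. -/
theorem frame_expansion {ep en : E} (h : IsSplitFrame F ep en) (a b a' b' : ℂ) :
    F.B (a • ep + b • en) (a' • ep + b' • en)
      = a * (starRingEnd ℂ) a' - b * (starRingEnd ℂ) b' := by
  rw [F.add_left, F.smul_left, F.smul_left, F.add_right, F.add_right,
    F.smul_right, F.smul_right, F.smul_right, F.smul_right,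
    h.pos, h.neg, h.orth, h.orth']
  ring

/-- Frames are linearly independent (their Gram matrix is invertible) — the
non-degeneracy certificate. -/
theorem coeff_eq_zero {ep en : E} (h : IsSplitFrame F ep en) {a b : ℂ}
    (h0 : a • ep + b • en = 0) : a = 0 ∧ b = 0 := by
  have h1 : F.B (a • ep + b • en) ep = 0 := by rw [h0, F.zero_left]
  have h2 : F.B (a • ep + b • en) en = 0 := by rw [h0, F.zero_left]
  rw [F.add_left, F.smul_left, F.smul_left, h.pos, h.orth'] at h1
  rw [F.add_left, F.smul_left, F.smul_left, h.orth, h.neg] at h2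
  simp at h1 h2
  exact ⟨h1, h2⟩

end IsSplitFrame

/-- **The tier-A Witt lemma, sign-to-sign** (plan C4a(ii), [PerL] ll. 476–478,
341–345): for any two orthogonal (+,−) frames of the same hermitian plane, the
coordinate map a·e₊ + b·e₋ ↦ a·e′₊ + b·e′₋ preserves the form — the two adapted
decompositions are isometric with + matched to + and − to −, which is why e_b
depends only on the sign of the line at b. -/
theorem witt_sign_to_sign {E : Type} [AddCommGroup E] [Module ℂ E] {F : SesqForm E}
    {ep en ep' en' : E} (h : IsSplitFrame F ep en) (h' : IsSplitFrame F ep' en')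
    (a b a' b' : ℂ) :
    F.B (a • ep + b • en) (a' • ep + b' • en)
      = F.B (a • ep' + b • en') (a' • ep' + b' • en') := by
  rw [h.frame_expansion, h'.frame_expansion]

/-! ## The H_occ discharge (lem:arch(c) → the frozen (dagger), ll. 442–443) -/

/-- **Per-side H_occ discharge package** over the M1 point extension.  The composite
field `arch_functional` is the print chain of ll. 513–523 in the shape that leaves
the functional analysis DERIVED: from a nonzero point evaluation of 𝒯_Φ on σ̂ it
produces a MODIFIED Fock–Schwartz index Φ₀ (φ⁰_b ⊗ (⋯) with the fixed data at the
other places, l. 518) and a point p₀ such that the DERIVED functional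
l = `pointFunctional` Φ₀ p₀ (continuity = A#8(iii), proved above) is P_w-averaged
(l ∘ P_w = l, from l(R(t)v) = w_b(t)·l(v) and P = ∫ w̄_b(t) R(t) dt, ll. 520–523 —
S2's A4 `isoProj` content) and still nonzero on σ̂.  Its justification consumes, per
A#9: (i) infinitesimal invariance ⟨XΦ,v⟩ = −⟨Φ,Xv⟩ on Gårding vectors OR topological
cyclicity of φ⁰_b in the smooth κ_b-part (ll. 515–518); (ii) the density of BOTH the
(12)- and (34)-adapted Fock models in the same smooth ω_{W,b} with the same
κ_b-part, whose bookkeeping brick is `witt_sign_to_sign` above (ll. 341–345,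
505–513); and AX3's Fock generation lem:arch(b) — at ι₁ WITH the vacuum ν = (0,0,−2)
of S2's `A3i_kappaPart_iff` + `A3i_nu_delivery` under the named hypothesis
μ_W = μ₁μ₂ (x1 M1 warning: the one place H_occ could be discharged from a false
lemma; the false branch ν = (1,1,−1) = S2's `A3i_false_*` is excluded exactly by
that delivery). -/
structure OccDischarge {C : IsolationCore H HG CG G SK SigIdx SigIdxG}
    (D : TorusData C) (P : PointedCore C) where
  /-- ADDED HYPOTHESIS (M1): the semantic definition of the bare frozen `wOccurs` —
  "w occurs in σ_∞|_{T(L₀⊗ℝ)}" holds as soon as the w-isotypic projection P_w is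
  nonzero somewhere on σ̂ ([PerL] ll. 387–390, 521–523: "Pv ≠ 0: σ̂, hence σ,
  contains a non-zero vector on which T_b acts by w_b").  The frozen field is a bare
  predicate, so C4a proves occurrence in THIS meaning and transfers through this
  bridge. -/
  wOccurs_of_Pw : ∀ i, (∃ v ∈ C.hatσ i, D.Pw v ≠ 0) → D.wOccurs i
  /-- ADDED HYPOTHESIS (M1) + COMPOSITE [A#9(i)(ii), AX3, S2-A4] (ll. 513–523, as
  documented in the structure docstring): the modified-vector functional package. -/
  arch_functional : ∀ (Φ : SK) (i : SigIdx) (p : P.Pt),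
    (∃ v ∈ C.hatσ i, P.evalPt p (C.TΦc Φ v) ≠ 0) →
    ∃ (Φ₀ : SK) (p₀ : P.Pt),
      (∀ v : H, pointFunctional C P Φ₀ p₀ (D.Pw v) = pointFunctional C P Φ₀ p₀ v) ∧
      ∃ v ∈ C.hatσ i, pointFunctional C P Φ₀ p₀ v ≠ 0

namespace OccDischarge

variable {C : IsolationCore H HG CG G SK SigIdx SigIdxG} {D : TorusData C}
variable {P : PointedCore C}

/-- **The H_occ discharge** ([PerL] ll. 442–443 (dagger) from lem:arch(c),
ll. 488–523): if 𝒯_Φ|_{σ̂} ≠ 0 then w occurs in σ_∞ — verbatim the shape of the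
frozen `IsolationSetting.H_occ12/34`.  Proof: L² nonvanishing → sup nonvanishing →
a nonzero point evaluation (M1) → the composite's P_w-averaged functional l with
l(v₀) ≠ 0 on σ̂ → P_w v₀ ≠ 0 (else l(v₀) = l(P_w v₀) = l(0) = 0) → occurrence. -/
theorem H_occ (O : OccDischarge D P) :
    ∀ (Φ : SK) (i : SigIdx), (∃ v ∈ C.hatσ i, C.TΦ Φ v ≠ 0) → D.wOccurs i := by
  intro Φ i h
  obtain ⟨v, hv, hTv⟩ := h
  obtain ⟨p, hp⟩ := exists_evalPt_ne_zero C P (TΦc_ne_zero C hTv)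
  obtain ⟨Φ₀, p₀, hPw, w, hw, hlw⟩ := O.arch_functional Φ i p ⟨v, hv, hp⟩
  apply O.wOccurs_of_Pw i
  refine ⟨w, hw, fun hPwz => hlw ?_⟩
  rw [← hPw w, hPwz, map_zero]

end OccDischarge

/-- **The discharge capstone**: a full `IsolationSetting` assembled from the shared
core, two torus sides, and the C4/C4a packages — H_chars from the two
`CharsDischarge`s (Lemma 4.2(b)), H_occ from the two `OccDischarge`s (Lemma 4.1(c)).
The w-coherence pin of the x1 cross-read holds by CONSTRUCTION: each package
references its own side's `D.Pw` / `D.wOccurs` / `D.allowed`, so the three symbols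
are tied to the same w per side. -/
def mkIsolationSetting (tA tB : TorusData C) {V₁ V₂ : Type} (P : PointedCore C)
    (chA : C4.CharsDischarge tA V₁) (chB : C4.CharsDischarge tB V₂)
    (ocA : OccDischarge tA P) (ocB : OccDischarge tB P) :
    IsolationSetting H HG CG G SK SigIdx SigIdxG where
  core := C
  t12 := tA
  t34 := tB
  H_chars12 := chA.H_chars
  H_chars34 := chB.H_chars
  H_occ12 := ocA.H_occ
  H_occ34 := ocB.H_occ

end C4a
end Perl34

end Summit.HodgeConjecture.CorCM.Prior.Perl34File
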